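import Summits.Ventures.PercRepro.ProfileTwoDeletion

/-!
# PercRepro — THE ASSEMBLY WITH ONE DELETION STEP PER MATROID AND LEVEL
(p10, gen 3; S5 §2.5 of `proofs/SUBCLAIM-S5-p10.md`; answers ref-2's flag G1)

`indep2_of_delStep` (ProfileTwoDeletion) assumes the deletion step `DelStep N z u` for EVERY `z` and EVERY level
`u ≤ ρ(E)`.  The case structure of S5 §2.5 produces the step for ONE element `z` per simple matroid and level
`u ≤ ρ(E) − 1`, and handles the top level `u = ρ(E)` separately (by duality).  This file states the assembly
in exactly that form: a top-level hypothesis `Indep2 N (ρ(E))` for every simple `N`, and an existential step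
`∃ z ∈ E, DelStep N z u` for every simple `N` with `≥ u + 3` elements and `u + 1 ≤ ρ(E)`.  Same induction.

* **`indep2_of_delStep_exists`** — the assembly with `∃ z` per level below the top and the top level assumed.
-/

open scoped Matroid

namespace PercRepro.Cogirth

open Finset ThmH Skew Shadow Profile

variable {α : Type} [DecidableEq α]

/-- **The assembly, existential form.**  If `INDEP_{2,ρ(E)}` holds on every simple matroid (the top level) and
every simple matroid `N` with `≥ u + 3` elements and `u + 1 ≤ ρ(E)` has SOME element `z` with
`DelStep N z u`, then `INDEP_{2,u}` holds on every simple matroid at every level `u ≥ 3`. -/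
theorem indep2_of_delStep_exists
    (htop : ∀ (N : Matroid α) [N.Finite], Simple' N → Indep2 N (rk N (gr N)))
    (hstep : ∀ (N : Matroid α) [N.Finite], Simple' N → ∀ u : ℕ, 3 ≤ u →
      u + 3 ≤ (gr N).card → u + 1 ≤ rk N (gr N) → ∃ z ∈ gr N, DelStep N z u) :
    ∀ (n : ℕ) (M : Matroid α) [M.Finite], (gr M).card = n → Simple' M →
      ∀ u : ℕ, 3 ≤ u → Indep2 M u := by
  intro n
  induction n using Nat.strong_induction_on with
  | _ n ih =>
    intro M _ hn hs u hu
    rcases Nat.lt_or_ge (rk M (gr M)) u with hlt | huR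
    · exact indep2_of_rk_lt hlt
    rcases Nat.eq_or_lt_of_le huR with heq | hltR
    · rw [heq]
      exact htop M hs
    rcases Nat.lt_or_ge n (u + 2) with hsmall | hbig
    · exact indep2_of_card_le (by omega) (by omega)
    rcases Nat.eq_or_lt_of_le hbig with heq2 | hgt
    · exact indep2_of_card_eq (by omega) (by omega)
    obtain ⟨z, hz, hstepz⟩ := hstep M hs u hu (by omega) hltR
    have hcard : (gr (M ＼ ({z} : Set α))).card = n - 1 := by
      rw [gr_delete', card_erase_of_mem hz, hn]
    have hih := ih (n - 1) (by omega) (M ＼ ({z} : Set α)) hcard (simple'_delete hs z) u hu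
    unfold Indep2 at hih ⊢
    unfold DelStep at hstepz
    rw [card_indepSets_eq_delete_add_through z u, mul_add]
    exact hstepz.trans (Nat.add_le_add_right hih _)

/-- The same, for one matroid. -/
theorem indep2_of_delStep_exists' {M : Matroid α} [M.Finite] (hs : Simple' M)
    (htop : ∀ (N : Matroid α) [N.Finite], Simple' N → Indep2 N (rk N (gr N)))
    (hstep : ∀ (N : Matroid α) [N.Finite], Simple' N → ∀ u : ℕ, 3 ≤ u →
      u + 3 ≤ (gr N).card → u + 1 ≤ rk N (gr N) → ∃ z ∈ gr N, DelStep N z u)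
    {u : ℕ} (hu : 3 ≤ u) : Indep2 M u :=
  indep2_of_delStep_exists htop hstep (gr M).card M rfl hs u hu

end PercRepro.Cogirth
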